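import Summits.SmoothPoincare4.SmoothPoincare4.Theorems.SullivanDualTargetOfSympcap
import Summits.SmoothPoincare4.SmoothPoincare4.Theorems.SullivanDualTargetStubLiouvilleCollarEuclid
import Summits.SmoothPoincare4.SmoothPoincare4.Theorems.SullivanDualTargetStubLiouvilleCollarChart
import Summits.SmoothPoincare4.SmoothPoincare4.Theorems.SullivanDualTargetStubLiouvilleCollarChartForm
import Literature.Geometry.Symplectic.GromovR4StdModel

/-!
# SmoothPoincare4 / SullivanDual — crux `Target` (stmt-SmoothPoincare4-7823), line `kaehler-jacket`,
# stub `stub_liouvilleCollar`: the Liouville collar (Geiges 2008, Lemma 5.2.4)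

In the situation of the apex of the line (a jacket `F : Σ ∖ p → ℝ⁴` immersive off `q`; radii
`0 < μ < μ'` with the closed `μ'`-chart-ball about `q` inside the chart `e_q` and missing `p`; a
smooth `1`-form `α` on `Σ ∖ p` with (PRIM) `dα = F^*ω₀` on a shell around the chart-sphere
`S_μ(q)`, (DUAL) `ω_F`-dual (Liouville) field `Z`, (OUT) `Z` pointing away from `q` along `S_μ(q)`,
(TEXT) `α|_{TS_μ(q)} = e^{u} α₀` through `θ = A⁻¹(μ⁻¹(e_q x − e_q q))`), there are `Ψ : Σ ∖ p → ℝ⁴`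
and `δ₁ > 0` such that on the shell `|‖e_q x − e_q q‖ − μ| < δ₁`: `Ψ` is `C^∞` with injective
differential and injective, `Ψ^*ω₀ = F^*ω₀`, `Ψ = e^{u(θ)/2} θ` on `S_μ(q)`, and
`‖e_q x − e_q q‖ < μ ⟺ Ψ x` lies inside the star-shaped hypersurface `{e^{u(θ)/2} θ}`
(`stub_liouvilleCollar`, the registered signature).

Proof: everything is read in the chart `e_q` through the chart section
`σ = e_q⁻¹ : ball (e_q q) μ' → Σ ∖ p` (`…CollarChart`, `…CollarChartForm`: the jacket becomes an
immersion `F ∘ σ` of a shell of `ℝ⁴`, `α` a smooth operator-valued map `a` with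
`Da(v)(w) − Da(w)(v) = (F ∘ σ)^*ω₀(v, w)`, `Z` the field `d e_q(Z ∘ σ)`), the chart-level collar
lemma `helper_kjEuclideanCollar` (`…CollarEuclid`: Liouville flow box `Λ`, star map `G`,
`Ψ̃ = G ∘ Λ⁻¹`, `Ψ̃^*ω₀ = (F ∘ σ)^*ω₀`) produces `Ψ̃`, and `Ψ = Ψ̃ ∘ e_q`.

References: H. Geiges, *An Introduction to Contact Topology*, CUP 2008, Lemma 5.2.4 and
Lemma/Definition 1.4.5 [Geiges2008].
-/

noncomputable section

set_option linter.dupNamespace false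

open scoped Manifold ContDiff Topology
open Set Function
open Literature.Geometry.Kaehler (MForm IsSmoothForm IsClosedForm mextDeriv)
open Literature.Geometry.Symplectic (punctured mem_punctured InPuncturedChartBall stdSymplecticForm
  inversion invertedStdForm IsSymplecticStandardNearPoint AgreesWithInvertedChartNear)
open Literature.Topology.FourManifolds (HomotopySphere)

namespace Summit.SmoothPoincare4.SmoothPoincare4.Theorems.Target.KaehlerJacket

/-- Model space `ℝ⁴ = ℂ²`. -/
local notation "E4" => EuclideanSpace ℝ (Fin 4)

/-- Pointwise reading of an identity `T ∘ T' = id` of continuous linear maps. [folklore] -/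
theorem apply_apply_of_comp_eq_id {X Y : Type*} [TopologicalSpace X] [AddCommMonoid X]
    [Module ℝ X] [TopologicalSpace Y] [AddCommMonoid Y] [Module ℝ Y]
    {T : Y →L[ℝ] X} {T' : X →L[ℝ] Y} (h : T.comp T' = ContinuousLinearMap.id ℝ X) (v : X) :
    T (T' v) = v :=
  congrArg (fun S : X →L[ℝ] X => S v) h

/-- **Stub 2 — the LIOUVILLE COLLAR (M; Geiges 2008, Lemma 5.2.4, with the computation
`(θ ↦ ρ(θ) θ)*λ₀ = ρ² α₀` for `λ₀ = ½ ω₀(y, dy)`).**  In the situation of Stub 1 (jacket `F`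
immersive off `q`; radii; smooth `α` with `dα = F*ω₀` and Liouville field `Z` on the shell, `Z`
outward along `S_μ(q)`; `α|S_μ(q) = e^{u} α₀` through `θ ↦ e_q⁻¹(c + μ A θ)`), there are a map
`Ψ : Σ ∖ p → ℝ⁴` and a width `δ₁ > 0` such that on the shell `|‖e_q x − c‖ − μ| < δ₁`: `Ψ` is `C^∞`
with injective differential and injective (an embedding of the shell); `Ψ*ω₀ = F*ω₀`; on the
sphere `Ψ(e_q⁻¹(c + μ A θ)) = e^{u(θ)/2} θ` (so `Ψ(S_μ(q))` is the star-shaped hypersurface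
`Y = {e^{u(θ)/2} θ}`); and `Ψ` carries the q-side `‖e_q x − c‖ < μ` exactly onto the inside of `Y`
(`‖Ψ x‖ < e^{u(Ψ x/‖Ψ x‖)/2}`).  Proof: `Ψ(φ^Z_t(e_q⁻¹(c + μ A θ))) := e^{t/2} e^{u(θ)/2} θ` —
flow box of the transverse field `Z` (smooth: `ω_F` is non-degenerate on the shell) matched with
the radial Liouville flow of `ω₀`; `Ψ*λ₀ = α` because both `1`-forms vanish on the Liouville field,
satisfy `L_Z β = β` and agree at `t = 0` by (TEXT); hence `Ψ*ω₀ = dα = F*ω₀`; sides from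
`t < 0 ⟺ q-side` (OUT).  Here: the chart-level lemma `helper_kjEuclideanCollar` transported
through `e_q`. [cite: Geiges2008, Lemma 5.2.4 and Lemma/Definition 1.4.5] -/
theorem stub_liouvilleCollar :
    ∀ (S : HomotopySphere 4) (p q : S.carrier) (F : punctured p → E4) (μ μ' δ : ℝ)
      (α : MForm (𝓡 4) (punctured p) ℝ 1) (Z : ∀ x : punctured p, TangentSpace (𝓡 4) x)
      (A : E4 ≃ₗᵢ[ℝ] E4) (u : E4 → ℝ),
      q ≠ p →
      (∀ x : punctured p, x.1 ≠ q →
        ContMDiffAt (𝓡 4) 𝓘(ℝ, E4) ∞ F x ∧ Injective (mfderiv (𝓡 4) 𝓘(ℝ, E4) F x)) →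
      0 < μ → μ < μ' → 0 < δ →
      Metric.closedBall (extChartAt (𝓡 4) q q) μ' ⊆ (extChartAt (𝓡 4) q).target →
      (∀ y ∈ Metric.closedBall (extChartAt (𝓡 4) q q) μ', (extChartAt (𝓡 4) q).symm y ≠ p) →
      IsSmoothForm α → ContDiff ℝ ∞ u →
      (∀ x : punctured p, x.1 ∈ (chartAt E4 q).source →
        |‖extChartAt (𝓡 4) q x.1 - extChartAt (𝓡 4) q q‖ - μ| < δ →
        ∀ v w : TangentSpace (𝓡 4) x, mextDeriv α x ![v, w] =
          stdSymplecticForm (mfderiv (𝓡 4) 𝓘(ℝ, E4) F x v) (mfderiv (𝓡 4) 𝓘(ℝ, E4) F x w)) →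
      (∀ x : punctured p, x.1 ∈ (chartAt E4 q).source →
        |‖extChartAt (𝓡 4) q x.1 - extChartAt (𝓡 4) q q‖ - μ| < δ →
        ∀ w : TangentSpace (𝓡 4) x,
          stdSymplecticForm (mfderiv (𝓡 4) 𝓘(ℝ, E4) F x (Z x)) (mfderiv (𝓡 4) 𝓘(ℝ, E4) F x w) =
            α x ![w]) →
      (∀ x : punctured p, x.1 ∈ (chartAt E4 q).source →
        ‖extChartAt (𝓡 4) q x.1 - extChartAt (𝓡 4) q q‖ = μ →
        0 < @inner ℝ E4 _ (mfderiv (𝓡 4) 𝓘(ℝ, E4) (fun z : punctured p => extChartAt (𝓡 4) q z.1) x (Z x))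
          (extChartAt (𝓡 4) q x.1 - extChartAt (𝓡 4) q q)) →
      (∀ x : punctured p, x.1 ∈ (chartAt E4 q).source →
        ‖extChartAt (𝓡 4) q x.1 - extChartAt (𝓡 4) q q‖ = μ →
        ∀ v : TangentSpace (𝓡 4) x,
          @inner ℝ E4 _ (mfderiv (𝓡 4) 𝓘(ℝ, E4) (fun z : punctured p => extChartAt (𝓡 4) q z.1) x v)
            (extChartAt (𝓡 4) q x.1 - extChartAt (𝓡 4) q q) = 0 →
          α x ![v] =
            Real.exp (u (A.symm (μ⁻¹ • (extChartAt (𝓡 4) q x.1 - extChartAt (𝓡 4) q q)))) *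
              (1 / 2 * stdSymplecticForm
                (A.symm (μ⁻¹ • (extChartAt (𝓡 4) q x.1 - extChartAt (𝓡 4) q q)))
                (A.symm (μ⁻¹ • (mfderiv (𝓡 4) 𝓘(ℝ, E4)
                  (fun z : punctured p => extChartAt (𝓡 4) q z.1) x v : E4))))) →
      ∃ (Ψ : punctured p → E4) (δ₁ : ℝ), 0 < δ₁ ∧
        (∀ x : punctured p, x.1 ∈ (chartAt E4 q).source →
          |‖extChartAt (𝓡 4) q x.1 - extChartAt (𝓡 4) q q‖ - μ| < δ₁ →
          ContMDiffAt (𝓡 4) 𝓘(ℝ, E4) ∞ Ψ x ∧ Injective (mfderiv (𝓡 4) 𝓘(ℝ, E4) Ψ x)) ∧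
        (∀ x y : punctured p, x.1 ∈ (chartAt E4 q).source →
          |‖extChartAt (𝓡 4) q x.1 - extChartAt (𝓡 4) q q‖ - μ| < δ₁ →
          y.1 ∈ (chartAt E4 q).source →
          |‖extChartAt (𝓡 4) q y.1 - extChartAt (𝓡 4) q q‖ - μ| < δ₁ → Ψ x = Ψ y → x = y) ∧
        (∀ x : punctured p, x.1 ∈ (chartAt E4 q).source →
          |‖extChartAt (𝓡 4) q x.1 - extChartAt (𝓡 4) q q‖ - μ| < δ₁ →
          ∀ v w : TangentSpace (𝓡 4) x,
            stdSymplecticForm (mfderiv (𝓡 4) 𝓘(ℝ, E4) Ψ x v) (mfderiv (𝓡 4) 𝓘(ℝ, E4) Ψ x w) =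
              stdSymplecticForm (mfderiv (𝓡 4) 𝓘(ℝ, E4) F x v) (mfderiv (𝓡 4) 𝓘(ℝ, E4) F x w)) ∧
        (∀ x : punctured p, x.1 ∈ (chartAt E4 q).source →
          ‖extChartAt (𝓡 4) q x.1 - extChartAt (𝓡 4) q q‖ = μ →
          Ψ x = Real.exp (u (A.symm (μ⁻¹ • (extChartAt (𝓡 4) q x.1 - extChartAt (𝓡 4) q q))) / 2) •
            A.symm (μ⁻¹ • (extChartAt (𝓡 4) q x.1 - extChartAt (𝓡 4) q q))) ∧
        (∀ x : punctured p, x.1 ∈ (chartAt E4 q).source →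
          |‖extChartAt (𝓡 4) q x.1 - extChartAt (𝓡 4) q q‖ - μ| < δ₁ →
          (‖extChartAt (𝓡 4) q x.1 - extChartAt (𝓡 4) q q‖ < μ ↔
            ‖Ψ x‖ < Real.exp (u (‖Ψ x‖⁻¹ • Ψ x) / 2)))  := by
  intro S p q F μ μ' δ α Z A u hq hF hμ hμμ' hδ hball havoid hα hu hprim hdual hout htext
  classical
  -- the chart section `σ = e⁻¹ : ball (e q) μ' → Σ ∖ p` (`e = extChartAt q`)
  have hqmem : q ∈ punctured p := mem_punctured.2 hq
  set σ : E4 → punctured p := fun y =>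
    if h : (extChartAt (𝓡 4) q).symm y ∈ punctured p then ⟨(extChartAt (𝓡 4) q).symm y, h⟩
    else ⟨q, hqmem⟩ with hσ_def
  have hσ : ∀ y ∈ Metric.ball (extChartAt (𝓡 4) q q) μ',
      (σ y).1 = (extChartAt (𝓡 4) q).symm y := by
    intro y hy
    have hmem : (extChartAt (𝓡 4) q).symm y ∈ punctured p :=
      mem_punctured.2 (havoid y (Metric.ball_subset_closedBall hy))
    show (dite ((extChartAt (𝓡 4) q).symm y ∈ punctured p)
      (fun h => (⟨(extChartAt (𝓡 4) q).symm y, h⟩ : punctured p)) fun _ => ⟨q, hqmem⟩).1 = _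
    rw [dif_pos hmem]
  obtain ⟨hT1, hT2⟩ := helper_kjChartTransport S p q μ' σ hball hσ
  -- the form `α` in the chart
  set a : E4 → E4 →L[ℝ] ℝ := fun y =>
    (ContinuousAlternatingMap.ofSubsingleton ℝ E4 ℝ (0 : Fin 1)).symm (α.pullback 𝓘(ℝ, E4) σ y)
    with ha_def
  have ha : ∀ y w, a y w = α.pullback 𝓘(ℝ, E4) σ y ![w] := by
    intro y w
    show (ContinuousAlternatingMap.ofSubsingleton ℝ E4 ℝ (0 : Fin 1)).symm
      (α.pullback 𝓘(ℝ, E4) σ y) w = _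
    rw [ContinuousAlternatingMap.ofSubsingleton_symm_apply_apply]
    congr 1
    funext i
    fin_cases i
    rfl
  have hform := helper_kjChartForm S p q μ' σ α a hball hσ hα ha
  -- the jacket and the Liouville field in the chart
  set Ft : E4 → E4 := fun y => F (σ y) with hFt_def
  set Zt : E4 → E4 := fun y => mfderiv (𝓡 4) 𝓘(ℝ, E4)
    (fun z : punctured p => extChartAt (𝓡 4) q z.1) (σ y) (Z (σ y)) with hZt_def
  -- the working width
  set δe : ℝ := min δ (min (μ / 2) ((μ' - μ) / 2)) with hδe_def
  have hδe : 0 < δe := lt_min hδ (lt_min (half_pos hμ) (by linarith))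
  have hδeδ : δe ≤ δ := min_le_left _ _
  have hδeμ2 : δe ≤ μ / 2 := (min_le_right _ _).trans (min_le_left _ _)
  have hδeμ' : δe ≤ (μ' - μ) / 2 := (min_le_right _ _).trans (min_le_right _ _)
  have hshell : ∀ y : E4, |‖y - extChartAt (𝓡 4) q q‖ - μ| < δe →
      y ∈ Metric.ball (extChartAt (𝓡 4) q q) μ' ∧ y ≠ extChartAt (𝓡 4) q q ∧
      |‖y - extChartAt (𝓡 4) q q‖ - μ| < δ := by
    intro y hy
    obtain ⟨h1, h2⟩ := abs_lt.1 hy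
    refine ⟨?_, ?_, lt_of_lt_of_le hy hδeδ⟩
    · rw [mem_ball_iff_norm]; linarith
    · intro h
      rw [h, sub_self, norm_zero] at h1
      linarith
  -- facts at a point `σ y` of the shell
  have hpt : ∀ y : E4, |‖y - extChartAt (𝓡 4) q q‖ - μ| < δe →
      (σ y).1 ∈ (chartAt E4 q).source ∧ extChartAt (𝓡 4) q (σ y).1 = y ∧ (σ y).1 ≠ q ∧
      |‖extChartAt (𝓡 4) q (σ y).1 - extChartAt (𝓡 4) q q‖ - μ| < δ := by
    intro y hy
    obtain ⟨hyb, hyc, hyδ⟩ := hshell y hy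
    obtain ⟨-, hsrc, heσ, -⟩ := hT1 y hyb
    refine ⟨hsrc, heσ, fun h => hyc ?_, by rw [heσ]; exact hyδ⟩
    rw [← heσ, h]
  -- pointwise chain rule for `Ft`
  have hDFt : ∀ y : E4, |‖y - extChartAt (𝓡 4) q q‖ - μ| < δe → ∀ v : E4,
      fderiv ℝ Ft y v = mfderiv (𝓡 4) 𝓘(ℝ, E4) F (σ y) (mfderiv 𝓘(ℝ, E4) (𝓡 4) σ y v) := by
    intro y hy v
    obtain ⟨hyb, -, -⟩ := hshell y hy
    obtain ⟨-, -, hxq, -⟩ := hpt y hy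
    obtain ⟨-, -, -, -, -, hΦ⟩ := hT1 y hyb
    exact congrArg (fun T : E4 →L[ℝ] E4 => T v) (hΦ F (hF (σ y) hxq).1).2
  -- (H1) smoothness, immersivity of `Ft`, smoothness of `a`
  have H1 : ∀ y : E4, |‖y - extChartAt (𝓡 4) q q‖ - μ| < δe →
      ContDiffAt ℝ ∞ Ft y ∧ Injective (fderiv ℝ Ft y) ∧ ContDiffAt ℝ ∞ a y := by
    intro y hy
    obtain ⟨hyb, -, -⟩ := hshell y hy
    obtain ⟨-, -, hxq, -⟩ := hpt y hy
    obtain ⟨-, -, -, hLD, -, hΦ⟩ := hT1 y hyb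
    obtain ⟨hFs, hFinj⟩ := hF (σ y) hxq
    refine ⟨(hΦ F hFs).1, ?_, (hform y hyb).1⟩
    intro v w hvw
    rw [hDFt y hy, hDFt y hy] at hvw
    have h2 := hFinj hvw
    rw [← apply_apply_of_comp_eq_id hLD v, ← apply_apply_of_comp_eq_id hLD w]
    exact congrArg _ h2
  -- (H2) `da = Ft^*ω₀`
  have H2 : ∀ y : E4, |‖y - extChartAt (𝓡 4) q q‖ - μ| < δe → ∀ v w : E4,
      fderiv ℝ a y v w - fderiv ℝ a y w v =
        stdSymplecticForm (fderiv ℝ Ft y v) (fderiv ℝ Ft y w) := by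
    intro y hy v w
    obtain ⟨hyb, -, -⟩ := hshell y hy
    obtain ⟨hsrc, -, -, hshδ⟩ := hpt y hy
    rw [(hform y hyb).2.2, hprim (σ y) hsrc hshδ, hDFt y hy, hDFt y hy]
  -- (H3) `Zt` is the `ω_{Ft}`-dual of `a`
  have H3 : ∀ y : E4, |‖y - extChartAt (𝓡 4) q q‖ - μ| < δe → ∀ w : E4,
      stdSymplecticForm (fderiv ℝ Ft y (Zt y)) (fderiv ℝ Ft y w) = a y w := by
    intro y hy w
    obtain ⟨hyb, -, -⟩ := hshell y hy
    obtain ⟨hsrc, -, -, hshδ⟩ := hpt y hy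
    obtain ⟨-, -, -, -, hDL, -⟩ := hT1 y hyb
    rw [hDFt y hy, hDFt y hy, (hform y hyb).2.1]
    have key : mfderiv 𝓘(ℝ, E4) (𝓡 4) σ y (Zt y) = Z (σ y) := apply_apply_of_comp_eq_id hDL _
    rw [key]
    exact hdual (σ y) hsrc hshδ _
  -- (H4) `Zt` points out of the sphere
  have H4 : ∀ y : E4, ‖y - extChartAt (𝓡 4) q q‖ = μ →
      0 < inner ℝ (Zt y) (y - extChartAt (𝓡 4) q q) := by
    intro y hy
    have hy' : |‖y - extChartAt (𝓡 4) q q‖ - μ| < δe := by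
      rw [hy, sub_self, abs_zero]; exact hδe
    obtain ⟨hsrc, heσ, -, -⟩ := hpt y hy'
    have h := hout (σ y) hsrc (by rw [heσ]; exact hy)
    rw [heσ] at h
    exact h
  -- (H5) the contact condition on the sphere
  have H5 : ∀ y : E4, ‖y - extChartAt (𝓡 4) q q‖ = μ → ∀ w : E4,
      inner ℝ w (y - extChartAt (𝓡 4) q q) = 0 →
      a y w = Real.exp (u (A.symm (μ⁻¹ • (y - extChartAt (𝓡 4) q q)))) *
        (1 / 2 * stdSymplecticForm (A.symm (μ⁻¹ • (y - extChartAt (𝓡 4) q q)))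
          (A.symm (μ⁻¹ • w))) := by
    intro y hy w hw
    have hy' : |‖y - extChartAt (𝓡 4) q q‖ - μ| < δe := by
      rw [hy, sub_self, abs_zero]; exact hδe
    obtain ⟨hyb, -, -⟩ := hshell y hy'
    obtain ⟨hsrc, heσ, -, -⟩ := hpt y hy'
    obtain ⟨-, -, -, hLD, -, -⟩ := hT1 y hyb
    have hLDw : mfderiv (𝓡 4) 𝓘(ℝ, E4) (fun z : punctured p => extChartAt (𝓡 4) q z.1) (σ y)
        (mfderiv 𝓘(ℝ, E4) (𝓡 4) σ y w) = w := apply_apply_of_comp_eq_id hLD w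
    have h := htext (σ y) hsrc (by rw [heσ]; exact hy) (mfderiv 𝓘(ℝ, E4) (𝓡 4) σ y w)
      (by rw [hLDw, heσ]; exact hw)
    rw [(hform y hyb).2.1, h, hLDw, heσ]
    rfl
  -- the chart-level collar
  obtain ⟨Ψt, δ₁, hδ₁, hδ₁e, hemb, hinj, hsymp, hsph, hside⟩ :=
    helper_kjEuclideanCollar (extChartAt (𝓡 4) q q) μ δe Ft a Zt A u hμ hδe
      (hδeμ2.trans (by linarith)) hu H1 H2 H3 H4 H5
  -- facts at a point `x` of the `δ₁`-shell
  have hx : ∀ x : punctured p, x.1 ∈ (chartAt E4 q).source →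
      |‖extChartAt (𝓡 4) q x.1 - extChartAt (𝓡 4) q q‖ - μ| < δ₁ →
      |‖extChartAt (𝓡 4) q x.1 - extChartAt (𝓡 4) q q‖ - μ| < δe ∧
      extChartAt (𝓡 4) q x.1 ∈ Metric.ball (extChartAt (𝓡 4) q q) μ' ∧ x.1 ≠ q := by
    intro x hxs hxδ
    have h1 : |‖extChartAt (𝓡 4) q x.1 - extChartAt (𝓡 4) q q‖ - μ| < δe :=
      lt_of_lt_of_le hxδ hδ₁e
    obtain ⟨hb, hne, -⟩ := hshell _ h1
    exact ⟨h1, hb, fun h => hne (by rw [h])⟩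
  refine ⟨fun x => Ψt (extChartAt (𝓡 4) q x.1), δ₁, hδ₁, ?_, ?_, ?_, ?_, ?_⟩
  · -- embedding of the shell
    intro x hxs hxδ
    obtain ⟨h1, hb, -⟩ := hx x hxs hxδ
    obtain ⟨hσx, -, -, hΨ⟩ := hT2 x hxs hb
    obtain ⟨hΨs, hDΨ⟩ := hΨ Ψt (hemb _ hxδ).1
    refine ⟨hΨs, ?_⟩
    obtain ⟨-, -, -, -, hDL, -⟩ := hT1 _ hb
    rw [hσx] at hDL
    intro v w hvw
    have hv := congrArg (fun T : TangentSpace (𝓡 4) x →L[ℝ] E4 => T v) hDΨ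
    have hw := congrArg (fun T : TangentSpace (𝓡 4) x →L[ℝ] E4 => T w) hDΨ
    have h2 := (hemb _ hxδ).2 ((hv.symm.trans hvw).trans hw)
    rw [← apply_apply_of_comp_eq_id hDL v, ← apply_apply_of_comp_eq_id hDL w]
    exact congrArg _ h2
  · -- injectivity
    intro x y hxs hxδ hys hyδ h
    have h3 : extChartAt (𝓡 4) q x.1 = extChartAt (𝓡 4) q y.1 := hinj _ _ hxδ hyδ h
    have hxs' : x.1 ∈ (extChartAt (𝓡 4) q).source := by rw [extChartAt_source]; exact hxs
    have hys' : y.1 ∈ (extChartAt (𝓡 4) q).source := by rw [extChartAt_source]; exact hys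
    exact Subtype.ext ((extChartAt (𝓡 4) q).injOn hxs' hys' h3)
  · -- `Ψ^*ω₀ = F^*ω₀`
    intro x hxs hxδ v w
    obtain ⟨h1, hb, hxq⟩ := hx x hxs hxδ
    obtain ⟨-, -, hΦ, hΨ⟩ := hT2 x hxs hb
    have hDΨ := (hΨ Ψt (hemb _ hxδ).1).2
    have hDF := (hΦ F (hF x hxq).1).2
    have e1 : ∀ v',
        mfderiv (𝓡 4) 𝓘(ℝ, E4) (fun z : punctured p => Ψt (extChartAt (𝓡 4) q z.1)) x v' =
        fderiv ℝ Ψt (extChartAt (𝓡 4) q x.1)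
          (mfderiv (𝓡 4) 𝓘(ℝ, E4) (fun z : punctured p => extChartAt (𝓡 4) q z.1) x v') :=
      fun v' => congrArg (fun T : TangentSpace (𝓡 4) x →L[ℝ] E4 => T v') hDΨ
    have e2 : ∀ v', mfderiv (𝓡 4) 𝓘(ℝ, E4) F x v' =
        fderiv ℝ Ft (extChartAt (𝓡 4) q x.1)
          (mfderiv (𝓡 4) 𝓘(ℝ, E4) (fun z : punctured p => extChartAt (𝓡 4) q z.1) x v') :=
      fun v' => congrArg (fun T : TangentSpace (𝓡 4) x →L[ℝ] E4 => T v') hDF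
    rw [e1, e1, e2, e2]
    exact hsymp _ hxδ _ _
  · -- the star-shaped model on the sphere
    intro x hxs hxμ
    exact hsph (extChartAt (𝓡 4) q x.1) hxμ
  · -- sides
    intro x _ hxδ
    exact hside (extChartAt (𝓡 4) q x.1) hxδ

end Summit.SmoothPoincare4.SmoothPoincare4.Theorems.Target.KaehlerJacket

end
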